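import Mathlib.Analysis.InnerProductSpace.PiL2
import Mathlib.Analysis.Calculus.ContDiff.Operations
import Mathlib.Analysis.Normed.Operator.BoundedLinearMaps
import HarnessLib

/-!
# Families of linear automorphisms given columnwise: smoothness of the family and its inverse

Topic `Analysis/Calculus`; namespace `Literature.Analysis.Calculus`.  Theorems only; no named
fact, no `sorry`.  A family `A : X → (ℝⁿ →L F)` of linear maps is `C^∞` (resp. continuous) as
a map into the operator-normed space as soon as each column `x ↦ A x eᵢ` is
(`contDiff_clm_of_apply_single`, `continuous_clm_of_apply_single`: `A x = Σᵢ eᵢ* ⊗ A x eᵢ`).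
Consequently, for a columnwise-`C^∞` (resp. continuous) family of automorphisms `A x` of `ℝⁿ`
and a `C^∞` (resp. continuous) family of vectors `v x`, the solved vector `(A x)⁻¹ (v x)` is
`C^∞` (resp. continuous) in `x` (`contDiff_symm_apply`, `continuous_symm_apply`), by smoothness
of inversion in the Banach algebra `ℝⁿ →L ℝⁿ` (Mathlib's `contDiffAt_ringInverse`).

## References

* [folklore] — smooth dependence of the inverse matrix on the matrix (Cramer's rule /
  Neumann series).
-/

noncomputable section

open Set Function
open scoped ContDiff

namespace Literature.Analysis.Calculus

variable {X : Type*} [NormedAddCommGroup X]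
  {F : Type*} [NormedAddCommGroup F] [NormedSpace ℝ F] {n : ℕ}

/-- **A linear map on `ℝⁿ` is the sum of its rank-one pieces** `eᵢ* ⊗ L eᵢ`. [folklore] -/
theorem clm_eq_sum_smulRight (L : EuclideanSpace ℝ (Fin n) →L[ℝ] F) :
    L = ∑ i, (EuclideanSpace.proj i).smulRight (L (EuclideanSpace.single i 1)) := by
  ext u
  have hu : u = ∑ i, u i • EuclideanSpace.single i (1 : ℝ) := by
    conv_lhs => rw [← (EuclideanSpace.basisFun (Fin n) ℝ).sum_repr u]
    simp [EuclideanSpace.basisFun_apply]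
  conv_lhs => rw [hu]
  simp [map_sum, map_smul]

/-- **Columnwise `C^∞` families of linear maps on `ℝⁿ` are `C^∞`** into the operator-normed
space. [folklore] -/
theorem contDiff_clm_of_apply_single [NormedSpace ℝ X]
    {A : X → (EuclideanSpace ℝ (Fin n) →L[ℝ] F)}
    (hA : ∀ i, ContDiff ℝ ∞ fun x ↦ A x (EuclideanSpace.single i 1)) : ContDiff ℝ ∞ A := by
  have h : A = fun x ↦ ∑ i, (EuclideanSpace.proj i).smulRight (A x (EuclideanSpace.single i 1)) :=
    funext fun x ↦ clm_eq_sum_smulRight (A x)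
  rw [h]
  refine ContDiff.sum fun i _ ↦ ?_
  exact (ContinuousLinearMap.smulRightL ℝ (EuclideanSpace ℝ (Fin n)) F
    (EuclideanSpace.proj i)).contDiff.comp (hA i)

/-- **Columnwise continuous families of linear maps on `ℝⁿ` are continuous** into the
operator-normed space. [folklore] -/
theorem continuous_clm_of_apply_single {A : X → (EuclideanSpace ℝ (Fin n) →L[ℝ] F)}
    (hA : ∀ i, Continuous fun x ↦ A x (EuclideanSpace.single i 1)) : Continuous A := by
  have h : A = fun x ↦ ∑ i, (EuclideanSpace.proj i).smulRight (A x (EuclideanSpace.single i 1)) :=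
    funext fun x ↦ clm_eq_sum_smulRight (A x)
  rw [h]
  refine continuous_finsetSum _ fun i _ ↦ ?_
  exact (ContinuousLinearMap.smulRightL ℝ (EuclideanSpace ℝ (Fin n)) F
    (EuclideanSpace.proj i)).continuous.comp (hA i)

/-- The inverse of an automorphism as the ring inverse of the underlying map. [folklore] -/
theorem symm_coe_eq_ringInverse (A : EuclideanSpace ℝ (Fin n) ≃L[ℝ] EuclideanSpace ℝ (Fin n)) :
    ((A.symm : EuclideanSpace ℝ (Fin n) ≃L[ℝ] EuclideanSpace ℝ (Fin n)) :
      EuclideanSpace ℝ (Fin n) →L[ℝ] EuclideanSpace ℝ (Fin n)) =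
      Ring.inverse (A : EuclideanSpace ℝ (Fin n) →L[ℝ] EuclideanSpace ℝ (Fin n)) := by
  rw [show (A : EuclideanSpace ℝ (Fin n) →L[ℝ] EuclideanSpace ℝ (Fin n)) = (A.toUnit : _) from rfl,
    Ring.inverse_unit]
  rfl

/-- **Solving a smoothly varying linear system smoothly**: for a columnwise-`C^∞` family of
automorphisms `A x` of `ℝⁿ` and a `C^∞` family `v x`, `x ↦ (A x)⁻¹ (v x)` is `C^∞`. [folklore] -/
theorem contDiff_symm_apply [NormedSpace ℝ X]
    {A : X → (EuclideanSpace ℝ (Fin n) ≃L[ℝ] EuclideanSpace ℝ (Fin n))}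
    (hA : ∀ i, ContDiff ℝ ∞ fun x ↦ A x (EuclideanSpace.single i 1))
    {v : X → EuclideanSpace ℝ (Fin n)} (hv : ContDiff ℝ ∞ v) :
    ContDiff ℝ ∞ fun x ↦ (A x).symm (v x) := by
  have hAc : ContDiff ℝ ∞ fun x ↦ (A x : EuclideanSpace ℝ (Fin n) →L[ℝ] EuclideanSpace ℝ (Fin n)) :=
    contDiff_clm_of_apply_single hA
  have hinv : ContDiff ℝ ∞ fun x ↦
      Ring.inverse (A x : EuclideanSpace ℝ (Fin n) →L[ℝ] EuclideanSpace ℝ (Fin n)) :=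
    contDiff_iff_contDiffAt.2 fun x ↦ by
      have h1 : ContDiffAt ℝ ∞ Ring.inverse
          ((fun x ↦ (A x : EuclideanSpace ℝ (Fin n) →L[ℝ] EuclideanSpace ℝ (Fin n))) x) :=
        contDiffAt_ringInverse ℝ (A x).toUnit
      exact h1.comp x hAc.contDiffAt
  have h : (fun x ↦ (A x).symm (v x)) = fun x ↦
      Ring.inverse (A x : EuclideanSpace ℝ (Fin n) →L[ℝ] EuclideanSpace ℝ (Fin n)) (v x) := by
    funext x
    rw [← symm_coe_eq_ringInverse]
    rfl
  rw [h]
  exact hinv.clm_apply hv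

/-- **Solving a continuously varying linear system continuously.** [folklore] -/
theorem continuous_symm_apply {A : X → (EuclideanSpace ℝ (Fin n) ≃L[ℝ] EuclideanSpace ℝ (Fin n))}
    (hA : ∀ i, Continuous fun x ↦ A x (EuclideanSpace.single i 1))
    {v : X → EuclideanSpace ℝ (Fin n)} (hv : Continuous v) :
    Continuous fun x ↦ (A x).symm (v x) := by
  have hAc : Continuous fun x ↦ (A x : EuclideanSpace ℝ (Fin n) →L[ℝ] EuclideanSpace ℝ (Fin n)) :=
    continuous_clm_of_apply_single hA
  have hinv : Continuous fun x ↦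
      Ring.inverse (A x : EuclideanSpace ℝ (Fin n) →L[ℝ] EuclideanSpace ℝ (Fin n)) :=
    continuous_iff_continuousAt.2 fun x ↦ by
      have h1 : ContinuousAt Ring.inverse
          ((fun x ↦ (A x : EuclideanSpace ℝ (Fin n) →L[ℝ] EuclideanSpace ℝ (Fin n))) x) :=
        NormedRing.inverse_continuousAt (A x).toUnit
      exact ContinuousAt.comp (g := Ring.inverse)
        (f := fun x ↦ (A x : EuclideanSpace ℝ (Fin n) →L[ℝ] EuclideanSpace ℝ (Fin n))) (x := x)
        h1 hAc.continuousAt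
  have h : (fun x ↦ (A x).symm (v x)) = fun x ↦
      Ring.inverse (A x : EuclideanSpace ℝ (Fin n) →L[ℝ] EuclideanSpace ℝ (Fin n)) (v x) := by
    funext x
    rw [← symm_coe_eq_ringInverse]
    rfl
  rw [h]
  exact hinv.clm_apply hv

end Literature.Analysis.Calculus

end
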